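import Mathlib.Geometry.Euclidean.Inversion.Calculus
import Mathlib.Analysis.InnerProductSpace.Projection.FiniteDimensional
import Mathlib.Analysis.SpecialFunctions.Sqrt
import HarnessLib

/-!
# The chord map of the unit sphere through an interior point and its Jacobian

Topic `Literature/Analysis/Potential` (toolbox for the invariant Poisson kernel of the hyperbolic
ball, M. Stoll, *Harmonic and Subharmonic Function Theory on the Hyperbolic Ball*, CUP 2016
[Stoll2016], §2.1 and §5.3). Everything here is elementary Euclidean geometry and calculus in a
real inner product space `E`; all statements are fully proved (no named facts, no definitions).

For `x ∈ E` with `‖x‖ < 1` put `c(u) = (R/|u - x|)²`, `R = √(1 - ‖x‖²)` (the conformal factor of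
the inversion of centre `x` and radius `R`) and let `ψ(u) = x - c(u)(u - x)` be that inversion
followed by the point reflection through `x` ("chord map": for `|t| = 1`, `ψ(t)` is the second
intersection with the unit sphere of the chord through `t` and `x`, and `ψ|_𝕊` is Stoll's Möbius
involution `φ_x` of (2.1.6) restricted to `𝕊`); finally `Φ(y) = |y| ψ(y/|y|)` is the
`1`-homogeneous extension of `ψ|_𝕊`. To keep the statements short without introducing
definitions, the three maps enter every lemma as function variables `c`, `ψ`, `Φ` together with
their defining equations `hc`, `hψ`, `hΦ` (instantiate with `⟨_, fun _ => rfl⟩`). We prove: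

* `reflection_eq_chordMap`: for `|t| = 1`, `ψ(t)` is the reflection of `t` in the hyperplane
  `(t - x)^⊥`; hence `|ψ(t)| = 1` and (`chordMap_chordMap`, Stoll's Exercise 2.4.3 /
  Theorem 2.1.2(a)) `ψ ∘ ψ = id` on `𝕊`;
* `Φ` is a norm-preserving involution of `E ∖ {0}` mapping the punctured unit ball onto itself
  (`image_chordExt`, `injOn_chordExt`);
* `hasFDerivAt_chordExt`: `DΦ(t) = R_t ∘ L_t` at a unit vector `t`, where `R_t` is the reflection
  in `(t - x)^⊥` and `L_t = -c(t)·id + (1 + c(t))·proj_{ℝt}` (from Mathlib's derivative of the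
  inversion, `EuclideanGeometry.hasFDerivAt_inversion`), transferred along rays by homogeneity
  (`hasFDerivAt_chordExt_of_ne_zero`);
* `abs_det_reflection_comp`: `|det (R_t ∘ L_t)| = c(t)^(dim E - 1)` — on the unit sphere of `ℝⁿ`
  this is the invariant Poisson kernel `P_h(x,t) = ((1 - |x|²)/|t - x|²)^(n-1)` of
  [Stoll2016, (5.1.5)], i.e. the Jacobian of `φ_x|_𝕊` with respect to surface measure, which is the
  content of [Stoll2016, (5.3.1)].

Used by `Literature/Analysis/Potential/HyperbolicPoissonKernelProofs.lean` (discharge of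
Stoll's Lemma 5.3.1(c)). Not here: anything measure-theoretic.
-/

noncomputable section

open Metric Set Module

open scoped RealInnerProductSpace

namespace Literature.Analysis.Potential

namespace SphereChordMap

section Normed

variable {E : Type*} [NormedAddCommGroup E] [NormedSpace ℝ E] {x : E} {c : E → ℝ} {ψ Φ : E → E}

omit [NormedSpace ℝ E] in
/-- The conformal factor in closed form: `c(u) = (1 - ‖x‖²)/‖u - x‖²` (`‖x‖ ≤ 1`). [folklore] -/
theorem chordFactor_eq (hc : ∀ u, c u = (√(1 - ‖x‖ ^ 2) / dist u x) ^ 2) (hx : ‖x‖ ≤ 1)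
    (u : E) : c u = (1 - ‖x‖ ^ 2) / ‖u - x‖ ^ 2 := by
  rw [hc, div_pow, Real.sq_sqrt (by nlinarith [norm_nonneg x]), dist_eq_norm]

omit [NormedSpace ℝ E] in
/-- `c(u) ≥ 0`. [folklore] -/
theorem chordFactor_nonneg (hc : ∀ u, c u = (√(1 - ‖x‖ ^ 2) / dist u x) ^ 2) (u : E) :
    0 ≤ c u := by
  rw [hc]; exact sq_nonneg _

omit [NormedSpace ℝ E] in
/-- A unit vector is not a point of the open unit ball: `‖t - x‖ ≠ 0`. [folklore] -/
theorem norm_sub_ne_zero (hx : ‖x‖ < 1) {t : E} (ht : ‖t‖ = 1) : ‖t - x‖ ≠ 0 := by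
  intro h
  rw [norm_sub_eq_zero_iff] at h
  rw [h] at ht
  exact absurd ht (ne_of_lt hx)

omit [NormedSpace ℝ E] in
/-- `c(t) > 0` for `‖x‖ < 1 = ‖t‖`. [folklore] -/
theorem chordFactor_pos (hc : ∀ u, c u = (√(1 - ‖x‖ ^ 2) / dist u x) ^ 2) (hx : ‖x‖ < 1)
    {t : E} (ht : ‖t‖ = 1) : 0 < c t := by
  rw [chordFactor_eq hc hx.le]
  have h1 : 0 < 1 - ‖x‖ ^ 2 := by nlinarith [norm_nonneg x]
  have h2 : 0 < ‖t - x‖ := (norm_nonneg _).lt_of_ne (norm_sub_ne_zero hx ht).symm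
  positivity

/-- `ψ(t) - x = -c(t) (t - x)`: `ψ(t)` lies on the line through `x` and `t`. [folklore] -/
theorem chordMap_sub_center (hψ : ∀ u, ψ u = x - c u • (u - x)) (t : E) :
    ψ t - x = -(c t • (t - x)) := by
  rw [hψ]; abel

/-- Normalisation is `0`-homogeneous: `(r y)/‖r y‖ = y/‖y‖` for `r > 0`. [folklore] -/
theorem normalize_smul {r : ℝ} (hr : 0 < r) (y : E) : ‖r • y‖⁻¹ • (r • y) = ‖y‖⁻¹ • y := by
  by_cases hy : y = 0
  · simp [hy]
  · rw [norm_smul, Real.norm_of_nonneg hr.le, smul_smul, mul_inv, mul_comm r⁻¹, mul_assoc,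
      inv_mul_cancel₀ hr.ne', mul_one]

/-- `Φ` is `1`-homogeneous: `Φ(r y) = r Φ(y)` for `r > 0`. [folklore] -/
theorem chordExt_smul (hΦ : ∀ y, Φ y = ‖y‖ • ψ (‖y‖⁻¹ • y)) {r : ℝ} (hr : 0 < r) (y : E) :
    Φ (r • y) = r • Φ y := by
  rw [hΦ (r • y), hΦ y, normalize_smul hr y, norm_smul, Real.norm_of_nonneg hr.le, mul_smul]

end Normed

section Inner

variable {E : Type*} [NormedAddCommGroup E] [InnerProductSpace ℝ E] {x : E} {c : E → ℝ}
  {ψ Φ : E → E}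

/-- **Chord lemma**: for `‖t‖ = 1 > ‖x‖`, `ψ(t)` is the reflection of `t` in the hyperplane
`(t - x)^⊥` (the hyperplane through the centre perpendicular to a chord swaps its endpoints).
[folklore] -/
theorem reflection_eq_chordMap (hc : ∀ u, c u = (√(1 - ‖x‖ ^ 2) / dist u x) ^ 2)
    (hψ : ∀ u, ψ u = x - c u • (u - x)) (hx : ‖x‖ < 1) {t : E} (ht : ‖t‖ = 1) :
    (ℝ ∙ (t - x))ᗮ.reflection t = ψ t := by
  have hd : ‖t - x‖ ≠ 0 := norm_sub_ne_zero hx ht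
  have hd2 : ‖t - x‖ ^ 2 ≠ 0 := pow_ne_zero 2 hd
  rw [Submodule.reflection_orthogonal_apply, Submodule.reflection_singleton_apply, hψ,
    chordFactor_eq hc hx.le]
  have h1 : ⟪t - x, t⟫ = 1 - ⟪x, t⟫ := by
    rw [inner_sub_left, real_inner_self_eq_norm_sq, ht]; ring
  have h2 : ‖t - x‖ ^ 2 = 1 - 2 * ⟪x, t⟫ + ‖x‖ ^ 2 := by
    rw [norm_sub_sq_real, ht, real_inner_comm]; ring
  have key : (2 : ℝ) * (⟪t - x, t⟫ / ‖t - x‖ ^ 2) = 1 + (1 - ‖x‖ ^ 2) / ‖t - x‖ ^ 2 := by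
    have h3 : 2 * ⟪t - x, t⟫ = ‖t - x‖ ^ 2 + (1 - ‖x‖ ^ 2) := by rw [h1, h2]; ring
    field_simp
    linarith [h3]
  have key' : (2 : ℝ) • ((⟪t - x, t⟫ / ‖t - x‖ ^ 2) • (t - x)) =
      (1 + (1 - ‖x‖ ^ 2) / ‖t - x‖ ^ 2) • (t - x) := by
    rw [smul_smul, key]
  simp only [RCLike.ofReal_real_eq_id, id_eq]
  rw [two_smul] at key'
  simp only [two_smul]
  rw [key']
  module

/-- `ψ` maps the unit sphere to itself: `‖ψ(t)‖ = 1` for `‖t‖ = 1 > ‖x‖`.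
[cite: Stoll2016, (2.1.7)] -/
theorem norm_chordMap (hc : ∀ u, c u = (√(1 - ‖x‖ ^ 2) / dist u x) ^ 2)
    (hψ : ∀ u, ψ u = x - c u • (u - x)) (hx : ‖x‖ < 1) {t : E} (ht : ‖t‖ = 1) : ‖ψ t‖ = 1 := by
  rw [← reflection_eq_chordMap hc hψ hx ht, LinearIsometryEquiv.norm_map, ht]

/-- `c(ψ(t)) = c(t)⁻¹` on the sphere, i.e. `|x - ψ(t)| |x - t| = 1 - |x|²` (power of the point
`x`). [cite: Stoll2016, Exercise 2.4.3] -/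
theorem chordFactor_chordMap (hc : ∀ u, c u = (√(1 - ‖x‖ ^ 2) / dist u x) ^ 2)
    (hψ : ∀ u, ψ u = x - c u • (u - x)) (hx : ‖x‖ < 1) {t : E} (ht : ‖t‖ = 1) :
    c (ψ t) = (c t)⁻¹ := by
  have hd : ‖t - x‖ ≠ 0 := norm_sub_ne_zero hx ht
  have h1 : (0 : ℝ) < 1 - ‖x‖ ^ 2 := by nlinarith [norm_nonneg x]
  have hdist : dist (ψ t) x = (1 - ‖x‖ ^ 2) / ‖t - x‖ := by
    rw [dist_eq_norm, chordMap_sub_center hψ, norm_neg, norm_smul,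
      Real.norm_of_nonneg (chordFactor_nonneg hc t), chordFactor_eq hc hx.le]
    field_simp
  rw [hc (ψ t), hdist, chordFactor_eq hc hx.le t, div_pow, Real.sq_sqrt h1.le]
  field_simp

/-- `ψ` is an involution of the unit sphere (`‖x‖ < 1`). [cite: Stoll2016, Theorem 2.1.2(a)] -/
theorem chordMap_chordMap (hc : ∀ u, c u = (√(1 - ‖x‖ ^ 2) / dist u x) ^ 2)
    (hψ : ∀ u, ψ u = x - c u • (u - x)) (hx : ‖x‖ < 1) {t : E} (ht : ‖t‖ = 1) :
    ψ (ψ t) = t := by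
  have hc0 : c t ≠ 0 := (chordFactor_pos hc hx ht).ne'
  rw [hψ (ψ t), chordFactor_chordMap hc hψ hx ht, chordMap_sub_center hψ t, smul_neg, smul_smul,
    inv_mul_cancel₀ hc0, one_smul]
  abel

/-- `Φ` preserves the norm (`‖x‖ < 1`). [folklore] -/
theorem norm_chordExt (hc : ∀ u, c u = (√(1 - ‖x‖ ^ 2) / dist u x) ^ 2)
    (hψ : ∀ u, ψ u = x - c u • (u - x)) (hΦ : ∀ y, Φ y = ‖y‖ • ψ (‖y‖⁻¹ • y)) (hx : ‖x‖ < 1)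
    (y : E) : ‖Φ y‖ = ‖y‖ := by
  rw [hΦ]
  by_cases hy : y = 0
  · simp [hy]
  · have hn : ‖‖y‖⁻¹ • y‖ = 1 := by
      rw [norm_smul, norm_inv, norm_norm, inv_mul_cancel₀ (norm_ne_zero_iff.2 hy)]
    rw [norm_smul, norm_norm, norm_chordMap hc hψ hx hn, mul_one]

/-- `Φ` is an involution of `E ∖ {0}` (`‖x‖ < 1`). [folklore] -/
theorem chordExt_chordExt (hc : ∀ u, c u = (√(1 - ‖x‖ ^ 2) / dist u x) ^ 2)
    (hψ : ∀ u, ψ u = x - c u • (u - x)) (hΦ : ∀ y, Φ y = ‖y‖ • ψ (‖y‖⁻¹ • y)) (hx : ‖x‖ < 1)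
    {y : E} (hy : y ≠ 0) : Φ (Φ y) = y := by
  have hy' : ‖y‖ ≠ 0 := norm_ne_zero_iff.2 hy
  have hn : ‖‖y‖⁻¹ • y‖ = 1 := by rw [norm_smul, norm_inv, norm_norm, inv_mul_cancel₀ hy']
  have h1 : ‖Φ y‖ = ‖y‖ := norm_chordExt hc hψ hΦ hx y
  rw [hΦ (Φ y), h1, hΦ y, smul_smul, inv_mul_cancel₀ hy', one_smul,
    chordMap_chordMap hc hψ hx hn, smul_smul, mul_inv_cancel₀ hy', one_smul]

/-- `Φ` maps the punctured open unit ball into itself (`‖x‖ < 1`). [folklore] -/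
theorem chordExt_mem (hc : ∀ u, c u = (√(1 - ‖x‖ ^ 2) / dist u x) ^ 2)
    (hψ : ∀ u, ψ u = x - c u • (u - x)) (hΦ : ∀ y, Φ y = ‖y‖ • ψ (‖y‖⁻¹ • y)) (hx : ‖x‖ < 1)
    {y : E} (hy : y ∈ ball (0 : E) 1 \ {0}) : Φ y ∈ ball (0 : E) 1 \ {0} := by
  simp only [mem_sdiff, mem_ball_zero_iff, mem_singleton_iff] at hy ⊢
  refine ⟨by rw [norm_chordExt hc hψ hΦ hx]; exact hy.1, fun h => hy.2 ?_⟩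
  rw [← norm_eq_zero, ← norm_chordExt hc hψ hΦ hx y, h, norm_zero]

/-- `Φ` maps the punctured open unit ball ONTO itself (`‖x‖ < 1`). [folklore] -/
theorem image_chordExt (hc : ∀ u, c u = (√(1 - ‖x‖ ^ 2) / dist u x) ^ 2)
    (hψ : ∀ u, ψ u = x - c u • (u - x)) (hΦ : ∀ y, Φ y = ‖y‖ • ψ (‖y‖⁻¹ • y)) (hx : ‖x‖ < 1) :
    Φ '' (ball (0 : E) 1 \ {0}) = ball (0 : E) 1 \ {0} := by
  refine Subset.antisymm ?_ fun y hy =>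
    ⟨Φ y, chordExt_mem hc hψ hΦ hx hy, chordExt_chordExt hc hψ hΦ hx hy.2⟩
  rintro _ ⟨y, hy, rfl⟩
  exact chordExt_mem hc hψ hΦ hx hy

/-- `Φ` is injective on the punctured open unit ball (`‖x‖ < 1`). [folklore] -/
theorem injOn_chordExt (hc : ∀ u, c u = (√(1 - ‖x‖ ^ 2) / dist u x) ^ 2)
    (hψ : ∀ u, ψ u = x - c u • (u - x)) (hΦ : ∀ y, Φ y = ‖y‖ • ψ (‖y‖⁻¹ • y)) (hx : ‖x‖ < 1) :
    InjOn Φ (ball (0 : E) 1 \ {0}) := by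
  intro y hy z hz h
  rw [← chordExt_chordExt hc hψ hΦ hx hy.2, ← chordExt_chordExt hc hψ hΦ hx hz.2, h]

end Inner

section Deriv

variable {E : Type*} [NormedAddCommGroup E] [InnerProductSpace ℝ E] {x : E} {c : E → ℝ}
  {ψ Φ : E → E}

/-- The norm has derivative `⟪t, ·⟫` at a unit vector `t`. [folklore] -/
theorem hasFDerivAt_norm_of_norm_eq_one {t : E} (ht : ‖t‖ = 1) :
    HasFDerivAt (fun y : E => ‖y‖) (innerSL ℝ t) t := by
  have h1 : HasFDerivAt (fun y : E => √(‖y‖ ^ 2))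
      ((1 / (2 * √(‖t‖ ^ 2))) • (2 • innerSL ℝ t)) t :=
    (hasStrictFDerivAt_norm_sq t).hasFDerivAt.sqrt (by simp [ht])
  have h2 : (fun y : E => √(‖y‖ ^ 2)) = fun y => ‖y‖ :=
    funext fun y => Real.sqrt_sq (norm_nonneg y)
  rw [h2, ht] at h1
  refine h1.congr_fderiv ?_
  ext v
  simp [two_smul]
  ring

/-- The normalisation `y ↦ y/‖y‖` has derivative `v ↦ v - ⟪t, v⟫ t` at a unit vector `t`.
[folklore] -/
theorem hasFDerivAt_normalize_of_norm_eq_one {t : E} (ht : ‖t‖ = 1) :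
    HasFDerivAt (fun y : E => ‖y‖⁻¹ • y)
      (ContinuousLinearMap.id ℝ E - (innerSL ℝ t).smulRight t) t := by
  have hinv : HasFDerivAt (fun y : E => ‖y‖⁻¹) (-(‖t‖ ^ 2)⁻¹ • innerSL ℝ t) t :=
    (hasDerivAt_inv (by rw [ht]; exact one_ne_zero)).comp_hasFDerivAt t
      (hasFDerivAt_norm_of_norm_eq_one ht)
  have h := hinv.fun_smul (hasFDerivAt_id t)
  rw [ht] at h
  refine HasFDerivAt.congr_fderiv (h : HasFDerivAt (fun y : E => ‖y‖⁻¹ • y) _ t) ?_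
  ext v
  simp [sub_eq_add_neg, neg_smul]

/-- Derivative of the chord map off its centre: `Dψ(u) = -c(u) R_u`, `R_u` the reflection in
`(u - x)^⊥` (from Mathlib's derivative of the inversion). [folklore] -/
theorem hasFDerivAt_chordMap (hc : ∀ u, c u = (√(1 - ‖x‖ ^ 2) / dist u x) ^ 2)
    (hψ : ∀ u, ψ u = x - c u • (u - x)) {u : E} (hu : u ≠ x) :
    HasFDerivAt ψ (-(c u • ((ℝ ∙ (u - x))ᗮ.reflection : E →L[ℝ] E))) u := by
  have h := ((EuclideanGeometry.hasFDerivAt_inversion (R := √(1 - ‖x‖ ^ 2)) hu).sub_const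
    x).const_sub x
  have hfun : ψ = fun u => x - (EuclideanGeometry.inversion x (√(1 - ‖x‖ ^ 2)) u - x) := by
    funext u
    rw [hψ, hc]
    simp only [EuclideanGeometry.inversion, vsub_eq_sub, vadd_eq_add, add_sub_cancel_right]
  rw [hfun, hc u]
  exact h

/-- Derivative of `Φ` at a unit vector `t` (`‖x‖ < 1`): the reflection in `(t - x)^⊥` composed
with `-c(t)·id + (1 + c(t))·proj_{ℝt}`. [folklore] -/
theorem hasFDerivAt_chordExt (hc : ∀ u, c u = (√(1 - ‖x‖ ^ 2) / dist u x) ^ 2)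
    (hψ : ∀ u, ψ u = x - c u • (u - x)) (hΦ : ∀ y, Φ y = ‖y‖ • ψ (‖y‖⁻¹ • y)) (hx : ‖x‖ < 1)
    {t : E} (ht : ‖t‖ = 1) :
    HasFDerivAt Φ (((ℝ ∙ (t - x))ᗮ.reflection : E →L[ℝ] E) ∘L
      (-c t • ContinuousLinearMap.id ℝ E + (1 + c t) • (ℝ ∙ t).starProjection)) t := by
  have ht0 : t ≠ x := fun h => by rw [h] at ht; exact (ne_of_lt hx) ht
  have hUt : ‖t‖⁻¹ • t = t := by rw [ht, inv_one, one_smul]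
  have hN := hasFDerivAt_norm_of_norm_eq_one ht
  have hU := hasFDerivAt_normalize_of_norm_eq_one ht
  have hC : HasFDerivAt ψ (-(c t • ((ℝ ∙ (t - x))ᗮ.reflection : E →L[ℝ] E))) (‖t‖⁻¹ • t) := by
    rw [hUt]; exact hasFDerivAt_chordMap hc hψ ht0
  have h := hN.fun_smul (HasFDerivAt.comp t (f := fun y : E => ‖y‖⁻¹ • y) hC hU)
  refine (h.congr_of_eventuallyEq (f₁ := Φ) (Filter.Eventually.of_forall fun y => ?_)).congr_fderiv
    ?_
  · simp only [Function.comp_apply, hΦ]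
  have hkey := reflection_eq_chordMap hc hψ hx ht
  ext v
  simp only [add_apply, smul_apply, ContinuousLinearMap.comp_apply, neg_apply, sub_apply,
    ContinuousLinearMap.id_apply, ContinuousLinearMap.smulRight_apply,
    innerSL_apply_apply, Function.comp_apply, ContinuousLinearEquiv.coe_coe,
    LinearIsometryEquiv.coe_toContinuousLinearEquiv,
    Submodule.starProjection_unit_singleton ℝ ht, hUt, map_add, map_smul, map_sub, hkey]
  rw [ht, one_smul]
  module

/-- Derivative of `Φ` at any `y ≠ 0` (`‖x‖ < 1`): by `1`-homogeneity it is the derivative at the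
unit vector `y/‖y‖`. [folklore] -/
theorem hasFDerivAt_chordExt_of_ne_zero (hc : ∀ u, c u = (√(1 - ‖x‖ ^ 2) / dist u x) ^ 2)
    (hψ : ∀ u, ψ u = x - c u • (u - x)) (hΦ : ∀ y, Φ y = ‖y‖ • ψ (‖y‖⁻¹ • y)) (hx : ‖x‖ < 1)
    {y : E} (hy : y ≠ 0) :
    HasFDerivAt Φ (((ℝ ∙ (‖y‖⁻¹ • y - x))ᗮ.reflection : E →L[ℝ] E) ∘L
      (-c (‖y‖⁻¹ • y) • ContinuousLinearMap.id ℝ E +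
        (1 + c (‖y‖⁻¹ • y)) • (ℝ ∙ (‖y‖⁻¹ • y)).starProjection)) y := by
  have hr : 0 < ‖y‖ := norm_pos_iff.2 hy
  have hn : ‖‖y‖⁻¹ • y‖ = 1 := by
    rw [norm_smul, norm_inv, norm_norm, inv_mul_cancel₀ (norm_ne_zero_iff.2 hy)]
  have h0 := hasFDerivAt_chordExt hc hψ hΦ hx hn
  have h1 := (HasFDerivAt.comp y (f := fun z : E => ‖y‖⁻¹ • z) h0
    ((hasFDerivAt_id y).const_smul ‖y‖⁻¹)).const_smul ‖y‖
  refine (h1.congr_of_eventuallyEq (Filter.Eventually.of_forall fun z => ?_)).congr_fderiv ?_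
  · show Φ z = ‖y‖ • Φ (‖y‖⁻¹ • z)
    rw [← chordExt_smul hΦ hr, smul_smul, mul_inv_cancel₀ hr.ne', one_smul]
  ext v
  simp only [smul_apply, ContinuousLinearMap.comp_apply,
    ContinuousLinearMap.id_apply, map_smul, smul_smul, mul_inv_cancel₀ hr.ne', one_smul]

/-- `|det (R_t ∘ (-a·id + (1 + a)·proj_{ℝt}))| = a^(dim E - 1)` for a unit vector `t`, `a ≥ 0` and
`R_t` the reflection in `(t - x)^⊥`: the reflection has determinant `±1`
(`Submodule.det_reflection`), and the second factor is `1` on `ℝt` and `-a` on the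
`(dim E - 1)`-dimensional `t^⊥`. With `a = c(t)` on the unit sphere of `ℝⁿ` this is Stoll's
invariant Poisson kernel `P_h(x,t) = ((1-|x|²)/|t-x|²)^(n-1)`. [folklore] -/
theorem abs_det_reflection_comp [FiniteDimensional ℝ E] {t : E} (ht : ‖t‖ = 1) {a : ℝ}
    (ha : 0 ≤ a) :
    |(((ℝ ∙ (t - x))ᗮ.reflection : E →L[ℝ] E) ∘L
        (-a • ContinuousLinearMap.id ℝ E + (1 + a) • (ℝ ∙ t).starProjection)).det| =
      a ^ (finrank ℝ E - 1) := by
  have ht0 : t ≠ 0 := by rw [← norm_ne_zero_iff, ht]; exact one_ne_zero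
  set K : Submodule ℝ E := ℝ ∙ t with hK
  set L : E →L[ℝ] E := -a • ContinuousLinearMap.id ℝ E + (1 + a) • K.starProjection with hL
  have hdet : ((((ℝ ∙ (t - x))ᗮ).reflection : E →L[ℝ] E) ∘L L).det =
      LinearMap.det ((ℝ ∙ (t - x))ᗮ.reflection.toLinearEquiv : E →ₗ[ℝ] E) *
        LinearMap.det (L : E →ₗ[ℝ] E) := by
    rw [ContinuousLinearMap.det, ContinuousLinearMap.toLinearMap_comp, LinearMap.det_comp]
    rfl
  have h1 : |LinearMap.det ((ℝ ∙ (t - x))ᗮ.reflection.toLinearEquiv : E →ₗ[ℝ] E)| = 1 := by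
    rw [Submodule.det_reflection]
    simp
  have hLK : ∀ v ∈ K, L v = v := by
    intro v hv
    simp only [hL, add_apply, smul_apply, ContinuousLinearMap.id_apply,
      Submodule.starProjection_eq_self_iff.mpr hv]
    module
  have hLK' : ∀ w ∈ Kᗮ, L w = (-a) • w := by
    intro w hw
    simp only [hL, add_apply, smul_apply, ContinuousLinearMap.id_apply,
      (K.starProjection_apply_eq_zero_iff).mpr hw, smul_zero, add_zero]
  have hfin : finrank ℝ Kᗮ = finrank ℝ E - 1 := by
    have h := Submodule.finrank_add_finrank_orthogonal K
    rw [hK, finrank_span_singleton ht0] at h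
    rw [hK]
    omega
  have h2 : LinearMap.det (L : E →ₗ[ℝ] E) = (-a) ^ (finrank ℝ E - 1) := by
    let e := K.prodEquivOfIsCompl _ K.isCompl_orthogonal
    have key : (e.symm : E →ₗ[ℝ] K × Kᗮ) ∘ₗ (L : E →ₗ[ℝ] E) ∘ₗ
        (e.symm.symm : K × Kᗮ →ₗ[ℝ] E) =
        LinearMap.prodMap LinearMap.id ((-a) • LinearMap.id) := by
      apply LinearMap.ext
      rintro ⟨v, w⟩
      simp only [LinearMap.comp_apply, LinearEquiv.coe_coe, LinearEquiv.symm_symm, e,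
        Submodule.coe_prodEquivOfIsCompl', ContinuousLinearMap.coe_coe, map_add, hLK v v.2,
        hLK' w w.2, map_smul, Submodule.prodEquivOfIsCompl_symm_apply_left,
        Submodule.prodEquivOfIsCompl_symm_apply_right, LinearMap.prodMap_apply,
        LinearMap.id_apply, LinearMap.smul_apply]
      ext <;> simp
    rw [← LinearMap.det_conj (L : E →ₗ[ℝ] E) e.symm, key, LinearMap.det_prodMap,
      LinearMap.det_id, one_mul, LinearMap.det_smul, LinearMap.det_id, mul_one, hfin]
  rw [hdet, abs_mul, h1, one_mul, h2, abs_pow, abs_neg, abs_of_nonneg ha]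

end Deriv

end SphereChordMap

end Literature.Analysis.Potential

end
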